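import Summits.Parity.GeneralizedHardyLittlewood.Theses.ZDegreeToeplitzBand
import Literature.NumberTheory.LFunctions.Zhang2022.KnifeEdgeLenZDegreeShortDensePiece
import HarnessLib

/-!
# Route `ZDegreeToeplitzBand` — the CONDITIONAL KILL THEOREM of the C′ sign test
# `ShortPairsSchurClose` (stmt-Parity-20430), hypotheses only, over the REPAIRED side tables

Tenure call of the route planner (ls-knife-plan g1, HOME/INBOX 2026-08-27T13:52:44Z; kill-path line
`Cruxes/ShortPairsSchurClose/Lines/dark_schur.lean`, lines 44–105, byte-adapted WITHOUT its two `stub_*`, outside the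
`Cruxes` namespace), with the K0 binder RE-BOUND to the repaired item `InClassSideTablesPiece` (stmt-Parity-20459,
route rev 7/8; ls-knife-crit-1 g8 pre-read OBJECTION (3) 14:24:22Z: the original K0 `InClassSideTables`,
stmt-Parity-20016, is misstated as typed — `KnifeEdge.InClassMean` admits the sharp cutoff — so a kill modulo the
OLD K0 would be a kill modulo a dead input) through the `_piece` twins of the density reductions
(`KnifeEdge.crossTablePsiOn_zero_of_dense_piece` / `dualCrossTablePsiOn_zero_of_dense_piece`, and the ports
`crossTablePsiOn_short_zero_eventually_of_poly_piece` / `dualCrossTablePsiOn_short_zero_eventually_of_poly_piece`,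
`Zhang2022/KnifeEdgeLenZDegreeShortDensePiece.lean`, ls-knife-toeplitz-typer-1 g0, p538281).

The item `ShortPairsSchurClose` is a KILL-PATH NODE of the half-class (C′ = `KnifeEdge.ShortPairs`) decomposition
of K2: under the E₀|C′ = NULL DESIGN — the ψ-graded degree-1 CROSS and DUAL slots are DARK on short pairs (the
tables hold with the zero functional, eventually in `c′`) — the sign test applied to `X₁ = Y₁ = 0` would demand
`𝔅(g₁) < 0` for an in-class piece `g₁`, impossible since `mainTermForm ≥ 0` on `H¹` pieces
(`mainTermForm_nonneg_of_isH1`); so on the RECURRENT horn `¬ ForAllLarge ¬(A)` (the only branch on which K2 has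
content) the item is FALSE, and on the other horn it holds vacuously.  The tree records the equivalence
`shortPairsSchurClose_iff_notAEventually_of_dark` (Theorems/ZDegreeToeplitzBandClassSupport.lean, p531342); this file
stays OUT of that module's theses cone (imports: the route file and Literature only) and states the kill as theorems
whose hypotheses are exactly the named OPEN inputs the closure squad is landing (the repaired-K0 binder is written
UNFOLDED, `∃ c₀, ∀ c′ ≥ c₀, KnifeEdge.InClassMeanPiece c′` — by definition the route item `InClassSideTablesPiece`,
stmt-Parity-20459, so a holder of `h0 : InClassSideTablesPiece` passes `h0` as `hK0` verbatim):

* `crossDarkShort_of_dense_piece` / `dualDarkShort_of_dense_piece` — darkness of the degree-1 cross / dual slot on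
  ALL kinked short pairs, eventually in `c′`, FROM: darkness on a sub-class `𝒞₀` (display-level content, OPEN), the
  REPAIRED K0 for all large `c′` (`InClassSideTablesPiece`, stmt-Parity-20459, OPEN) and 𝔅-density of `𝒞₀` among the
  short pairs (hypothesis `hdense`); Zhang's Lemma 2.3 is discharged by the tree (`Skeleton.lemma23_eventually`);
* `not_shortPairsSchurClose_of_dark` — both short degree-1 slots dark ∧ (A)-characters recur ⇒
  `¬ ShortPairsSchurClose` (K0-free);
* `shortPairsSchurClose_of_notAEventually` — the vacuous horn, so the record shows BOTH horns;
* `not_shortPairsSchurClose_of_dense_piece`, `shortPairsSchurClose_iff_notAEventually_of_dense_piece` — the assembled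
  conditional kill / equivalence with a density HYPOTHESIS;
* `not_shortPairsSchurClose_of_polyDark_piece`, `shortPairsSchurClose_iff_notAEventually_of_polyDark_piece` — the
  same with the density leg DISCHARGED by the tree on every sub-class `𝒞₀ ⊇ KnifeEdge.PolyShortPairs`
  (`KnifeEdge.shortPairs_dense_of_poly`, p536434): hypotheses = repaired K0 ∧ poly-darkness of the cross slot ∧
  poly-darkness of the dual slot ∧ recurrence — nothing else;
* `not_shortPairsSchurClose_of_polyShortDark_piece` — the specialisation `𝒞₀ = 𝒞₀' = PolyShortPairs`.

SORRY-FREE, hypotheses only, «asserted by no one»: nothing here refutes the item outright (that needs the repaired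
K0 and the two poly-darkness statements as kernel theorems; then the refutation-on-the-recurrent-horn is ONE
application of `not_shortPairsSchurClose_of_polyShortDark_piece`).  Pure logic over tree theorems; standard axioms.
Cell landau-siegel §D, ls-knife-typer-3 g13 (prover hand).

«The programme SEARCHES and TYPES; no claim about Landau–Siegel zeros, Theorems 1–2 of
arXiv:2211.02515 or a repaired Margin232 until a kernel theorem says so.»
-/

namespace Summit.Parity.GeneralizedHardyLittlewood.Theorems

open Literature.NumberTheory.LFunctions.Zhang2022
open Literature.NumberTheory.LFunctions.Zhang2022.KnifeEdge
open Literature.NumberTheory.LFunctions.Zhang2022.Skeleton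
open Summit.Parity.GeneralizedHardyLittlewood.Theses.ZDegreeToeplitzBand

/-! ## The two dark slots from their OPEN inputs (density reductions over the repaired K0) -/

/-- **Degree-1 CROSS slot dark on all kinked short pairs, eventually in `c′`**, FROM: darkness of that slot on a
sub-class `𝒞₀` eventually in `c′` (OPEN, display-level), the REPAIRED K0 for all large `c′` (the route's
`InClassSideTablesPiece`, stmt-Parity-20459, OPEN) and 𝔅-density of `𝒞₀` among the short pairs with approximants of
controlled `mainTermForm`-distance (hypothesis `hdense`); Zhang's Lemma 2.3 comes from the tree
(`lemma23_eventually`).  Threshold = max of the three.  Engine: `KnifeEdge.crossTablePsiOn_zero_of_dense_piece`. -/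
theorem crossDarkShort_of_dense_piece {𝒞₀ : PairClass}
    (hdark : ∃ c₀ : ℝ, ∀ c' : ℝ, c₀ ≤ c' → CrossTablePsiOn c' 𝒞₀ 1 (fun _ _ _ _ => 0))
    (hK0 : ∃ c₀ : ℝ, ∀ c' : ℝ, c₀ ≤ c' → InClassMeanPiece c')
    (hdense : ∀ (f f' g g' : ℝ → ℂ), InClassPiece f f' → InClassPiece g g' → ShortPairs f f' g g' →
      ∀ η : ℝ, 0 < η → ∃ fN fN' gN gN' : ℝ → ℂ, InClassPiece fN fN' ∧ InClassPiece gN gN' ∧ 𝒞₀ fN fN' gN gN' ∧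
        mainTermForm (fun x => f x - fN x) (fun x => f' x - fN' x) ≤ η ∧
        mainTermForm (fun x => g x - gN x) (fun x => g' x - gN' x) ≤ η) :
    ∃ c₀ : ℝ, ∀ c' : ℝ, c₀ ≤ c' → CrossTablePsiOn c' ShortPairs 1 (fun _ _ _ _ => 0) := by
  obtain ⟨c₁, h1⟩ := hdark
  obtain ⟨c₂, h2⟩ := hK0
  obtain ⟨c₃, -, h3⟩ := lemma23_eventually
  refine ⟨max c₁ (max c₂ c₃), fun c' hc' => ?_⟩
  exact crossTablePsiOn_zero_of_dense_piece (h1 c' ((le_max_left _ _).trans hc'))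
    (h2 c' ((le_max_left _ _).trans ((le_max_right _ _).trans hc')))
    (h3 c' ((le_max_right _ _).trans ((le_max_right _ _).trans hc'))) hdense

/-- **Degree-1 DUAL slot dark on all kinked short pairs, eventually in `c′`**, FROM the dual twin of the same
three inputs (sub-class darkness of the dual slot, repaired K0 = `InClassSideTablesPiece`, 𝔅-density); Lemma 2.3
from the tree.  Engine: `KnifeEdge.dualCrossTablePsiOn_zero_of_dense_piece`. -/
theorem dualDarkShort_of_dense_piece {𝒞₀ : PairClass}
    (hdark : ∃ c₀ : ℝ, ∀ c' : ℝ, c₀ ≤ c' → DualCrossTablePsiOn c' 𝒞₀ 1 (fun _ _ _ _ => 0))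
    (hK0 : ∃ c₀ : ℝ, ∀ c' : ℝ, c₀ ≤ c' → InClassMeanPiece c')
    (hdense : ∀ (g₁ g₁' g₂ g₂' : ℝ → ℂ), InClassPiece g₁ g₁' → InClassPiece g₂ g₂' → ShortPairs g₁ g₁' g₂ g₂' →
      ∀ η : ℝ, 0 < η → ∃ g₁N g₁N' g₂N g₂N' : ℝ → ℂ, InClassPiece g₁N g₁N' ∧ InClassPiece g₂N g₂N' ∧
        𝒞₀ g₁N g₁N' g₂N g₂N' ∧
        mainTermForm (fun x => g₁ x - g₁N x) (fun x => g₁' x - g₁N' x) ≤ η ∧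
        mainTermForm (fun x => g₂ x - g₂N x) (fun x => g₂' x - g₂N' x) ≤ η) :
    ∃ c₀ : ℝ, ∀ c' : ℝ, c₀ ≤ c' → DualCrossTablePsiOn c' ShortPairs 1 (fun _ _ _ _ => 0) := by
  obtain ⟨c₁, h1⟩ := hdark
  obtain ⟨c₂, h2⟩ := hK0
  obtain ⟨c₃, -, h3⟩ := lemma23_eventually
  refine ⟨max c₁ (max c₂ c₃), fun c' hc' => ?_⟩
  exact dualCrossTablePsiOn_zero_of_dense_piece (h1 c' ((le_max_left _ _).trans hc'))
    (h2 c' ((le_max_left _ _).trans ((le_max_right _ _).trans hc')))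
    (h3 c' ((le_max_right _ _).trans ((le_max_right _ _).trans hc'))) hdense

/-! ## The kill on the recurrent horn, and the vacuous horn -/

/-- **KILL on the recurrent horn from the two dark slots** (K0-free): if BOTH ψ-graded degree-1 short slots are
dark (cross and dual tables hold with the zero functional, eventually in `c′`) and (A)-characters recur
(`¬ ForAllLarge ¬(A)`), then `ShortPairsSchurClose` is FALSE — the sign test at `X₁ = Y₁ = 0` would give an
in-class `g₁` with `𝔅(g₁) < 0`, contradicting `mainTermForm_nonneg_of_isH1`.  (One direction of the tree's
`shortPairsSchurClose_iff_notAEventually_of_dark`, p531342, re-derived here to stay out of that module's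
theses cone.) -/
theorem not_shortPairsSchurClose_of_dark
    (hX : ∃ c₀ : ℝ, ∀ c' : ℝ, c₀ ≤ c' → CrossTablePsiOn c' ShortPairs 1 (fun _ _ _ _ => 0))
    (hY : ∃ c₀ : ℝ, ∀ c' : ℝ, c₀ ≤ c' → DualCrossTablePsiOn c' ShortPairs 1 (fun _ _ _ _ => 0))
    (hrec : ¬ ForAllLarge (fun D _ χ => ¬ AssumptionA D χ)) :
    ¬ ShortPairsSchurClose := by
  intro h
  obtain ⟨c₀, hc₀⟩ := h hrec
  obtain ⟨cX, hcX⟩ := hX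
  obtain ⟨cY, hcY⟩ := hY
  obtain ⟨f, f', g₁, g₁', g₂, g₂', -, hg₁, -, -, -, -, -, -, hlt⟩ :=
    hc₀ (max c₀ (max cX cY)) (le_max_left _ _) _ _
      (hcX _ ((le_max_left _ _).trans (le_max_right _ _)))
      (hcY _ ((le_max_right _ _).trans (le_max_right _ _)))
  have h1 := mainTermForm_nonneg_of_isH1 hg₁.kinked.isH1
  simp only [norm_zero, ne_eq, OfNat.ofNat_ne_zero, not_false_eq_true, zero_pow, zero_div,
    add_zero] at hlt
  linarith

/-- **The vacuous horn**: if (A) fails for all large `D`, `ShortPairsSchurClose` holds (its own hypothesis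
`¬ ForAllLarge ¬(A)` is contradicted) — so the item is never «refuted outright» by the dark design, only
refuted on the recurrent horn. -/
theorem shortPairsSchurClose_of_notAEventually (hA : ForAllLarge (fun D _ χ => ¬ AssumptionA D χ)) :
    ShortPairsSchurClose :=
  fun h => absurd hA h

/-! ## The assembled conditional kill theorem — density as a HYPOTHESIS -/

/-- **CONDITIONAL KILL THEOREM of `ShortPairsSchurClose` (stmt-Parity-20430), density-hypothesis form** — each
hypothesis a named OPEN input of the closure squad: the repaired K0 (`InClassSideTablesPiece`, stmt-Parity-20459);
darkness of the degree-1 CROSS slot on a sub-class `𝒞₀` and of the DUAL slot on a sub-class `𝒞₀'` (eventually in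
`c′`); 𝔅-density of `𝒞₀` resp. `𝒞₀'` among the kinked short pairs; and recurrence of (A)-characters.  THEN the C′
sign test is FALSE.  Composition: `not_shortPairsSchurClose_of_dark ∘ (crossDarkShort_of_dense_piece,
dualDarkShort_of_dense_piece)`. -/
theorem not_shortPairsSchurClose_of_dense_piece {𝒞₀ 𝒞₀' : PairClass}
    (hK0 : ∃ c₀ : ℝ, ∀ c' : ℝ, c₀ ≤ c' → InClassMeanPiece c')
    (hdarkX : ∃ c₀ : ℝ, ∀ c' : ℝ, c₀ ≤ c' → CrossTablePsiOn c' 𝒞₀ 1 (fun _ _ _ _ => 0))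
    (hdarkY : ∃ c₀ : ℝ, ∀ c' : ℝ, c₀ ≤ c' → DualCrossTablePsiOn c' 𝒞₀' 1 (fun _ _ _ _ => 0))
    (hdenseX : ∀ (f f' g g' : ℝ → ℂ), InClassPiece f f' → InClassPiece g g' → ShortPairs f f' g g' →
      ∀ η : ℝ, 0 < η → ∃ fN fN' gN gN' : ℝ → ℂ, InClassPiece fN fN' ∧ InClassPiece gN gN' ∧ 𝒞₀ fN fN' gN gN' ∧
        mainTermForm (fun x => f x - fN x) (fun x => f' x - fN' x) ≤ η ∧
        mainTermForm (fun x => g x - gN x) (fun x => g' x - gN' x) ≤ η)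
    (hdenseY : ∀ (g₁ g₁' g₂ g₂' : ℝ → ℂ), InClassPiece g₁ g₁' → InClassPiece g₂ g₂' → ShortPairs g₁ g₁' g₂ g₂' →
      ∀ η : ℝ, 0 < η → ∃ g₁N g₁N' g₂N g₂N' : ℝ → ℂ, InClassPiece g₁N g₁N' ∧ InClassPiece g₂N g₂N' ∧
        𝒞₀' g₁N g₁N' g₂N g₂N' ∧
        mainTermForm (fun x => g₁ x - g₁N x) (fun x => g₁' x - g₁N' x) ≤ η ∧
        mainTermForm (fun x => g₂ x - g₂N x) (fun x => g₂' x - g₂N' x) ≤ η)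
    (hrec : ¬ ForAllLarge (fun D _ χ => ¬ AssumptionA D χ)) :
    ¬ ShortPairsSchurClose :=
  not_shortPairsSchurClose_of_dark (crossDarkShort_of_dense_piece hdarkX hK0 hdenseX)
    (dualDarkShort_of_dense_piece hdarkY hK0 hdenseY) hrec

/-- **Under the repaired K0, sub-class darkness and density, the item is EQUIVALENT to «(A) fails for all large
`D`»** (vacuous-true on that horn, false on the recurrent one).  The typed null result of the half-class sign
experiment, conditional on its named inputs. -/
theorem shortPairsSchurClose_iff_notAEventually_of_dense_piece {𝒞₀ 𝒞₀' : PairClass}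
    (hK0 : ∃ c₀ : ℝ, ∀ c' : ℝ, c₀ ≤ c' → InClassMeanPiece c')
    (hdarkX : ∃ c₀ : ℝ, ∀ c' : ℝ, c₀ ≤ c' → CrossTablePsiOn c' 𝒞₀ 1 (fun _ _ _ _ => 0))
    (hdarkY : ∃ c₀ : ℝ, ∀ c' : ℝ, c₀ ≤ c' → DualCrossTablePsiOn c' 𝒞₀' 1 (fun _ _ _ _ => 0))
    (hdenseX : ∀ (f f' g g' : ℝ → ℂ), InClassPiece f f' → InClassPiece g g' → ShortPairs f f' g g' →
      ∀ η : ℝ, 0 < η → ∃ fN fN' gN gN' : ℝ → ℂ, InClassPiece fN fN' ∧ InClassPiece gN gN' ∧ 𝒞₀ fN fN' gN gN' ∧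
        mainTermForm (fun x => f x - fN x) (fun x => f' x - fN' x) ≤ η ∧
        mainTermForm (fun x => g x - gN x) (fun x => g' x - gN' x) ≤ η)
    (hdenseY : ∀ (g₁ g₁' g₂ g₂' : ℝ → ℂ), InClassPiece g₁ g₁' → InClassPiece g₂ g₂' → ShortPairs g₁ g₁' g₂ g₂' →
      ∀ η : ℝ, 0 < η → ∃ g₁N g₁N' g₂N g₂N' : ℝ → ℂ, InClassPiece g₁N g₁N' ∧ InClassPiece g₂N g₂N' ∧
        𝒞₀' g₁N g₁N' g₂N g₂N' ∧
        mainTermForm (fun x => g₁ x - g₁N x) (fun x => g₁' x - g₁N' x) ≤ η ∧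
        mainTermForm (fun x => g₂ x - g₂N x) (fun x => g₂' x - g₂N' x) ≤ η) :
    ShortPairsSchurClose ↔ ForAllLarge (fun D _ χ => ¬ AssumptionA D χ) :=
  ⟨fun h => Classical.byContradiction fun hrec =>
      not_shortPairsSchurClose_of_dense_piece hK0 hdarkX hdarkY hdenseX hdenseY hrec h,
    shortPairsSchurClose_of_notAEventually⟩

/-! ## The assembled conditional kill theorem — density DISCHARGED on polynomial short pairs -/

/-- **CONDITIONAL KILL THEOREM of `ShortPairsSchurClose` (stmt-Parity-20430), poly-darkness form** — the density
leg is the tree's (`KnifeEdge.shortPairs_dense_of_poly`, through the ports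
`crossTablePsiOn_short_zero_eventually_of_poly_piece` / `dualCrossTablePsiOn_short_zero_eventually_of_poly_piece`),
so the hypotheses are ONLY: the repaired K0 (`InClassSideTablesPiece`, stmt-Parity-20459); darkness, for all large
`c′` (allowed to use the repaired K0 at `c′`), of the degree-1 CROSS slot on a sub-class `𝒞₀ ⊇ PolyShortPairs` and of
the DUAL slot on a sub-class `𝒞₀' ⊇ PolyShortPairs` (display-level content, OPEN); and recurrence of
(A)-characters.  THEN the C′ sign test is FALSE. -/
theorem not_shortPairsSchurClose_of_polyDark_piece {𝒞₀ 𝒞₀' : PairClass}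
    (h𝒞₀ : ∀ f f' g g', PolyShortPairs f f' g g' → 𝒞₀ f f' g g')
    (h𝒞₀' : ∀ f f' g g', PolyShortPairs f f' g g' → 𝒞₀' f f' g g')
    (hK0 : ∃ c₀ : ℝ, ∀ c' : ℝ, c₀ ≤ c' → InClassMeanPiece c')
    (hdarkX : ∃ c₀ : ℝ, ∀ c' : ℝ, c₀ ≤ c' → InClassMeanPiece c' → CrossTablePsiOn c' 𝒞₀ 1 (fun _ _ _ _ => 0))
    (hdarkY : ∃ c₀ : ℝ, ∀ c' : ℝ, c₀ ≤ c' → InClassMeanPiece c' →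
      DualCrossTablePsiOn c' 𝒞₀' 1 (fun _ _ _ _ => 0))
    (hrec : ¬ ForAllLarge (fun D _ χ => ¬ AssumptionA D χ)) :
    ¬ ShortPairsSchurClose :=
  not_shortPairsSchurClose_of_dark (crossTablePsiOn_short_zero_eventually_of_poly_piece h𝒞₀ hK0 hdarkX)
    (dualCrossTablePsiOn_short_zero_eventually_of_poly_piece h𝒞₀' hK0 hdarkY) hrec

/-- **Poly-darkness form of the equivalence**: repaired K0 ∧ poly-darkness (cross on `𝒞₀ ⊇ PolyShortPairs`, dual on
`𝒞₀' ⊇ PolyShortPairs`) ⇒ (`ShortPairsSchurClose ↔ ForAllLarge ¬(A)`). -/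
theorem shortPairsSchurClose_iff_notAEventually_of_polyDark_piece {𝒞₀ 𝒞₀' : PairClass}
    (h𝒞₀ : ∀ f f' g g', PolyShortPairs f f' g g' → 𝒞₀ f f' g g')
    (h𝒞₀' : ∀ f f' g g', PolyShortPairs f f' g g' → 𝒞₀' f f' g g')
    (hK0 : ∃ c₀ : ℝ, ∀ c' : ℝ, c₀ ≤ c' → InClassMeanPiece c')
    (hdarkX : ∃ c₀ : ℝ, ∀ c' : ℝ, c₀ ≤ c' → InClassMeanPiece c' → CrossTablePsiOn c' 𝒞₀ 1 (fun _ _ _ _ => 0))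
    (hdarkY : ∃ c₀ : ℝ, ∀ c' : ℝ, c₀ ≤ c' → InClassMeanPiece c' →
      DualCrossTablePsiOn c' 𝒞₀' 1 (fun _ _ _ _ => 0)) :
    ShortPairsSchurClose ↔ ForAllLarge (fun D _ χ => ¬ AssumptionA D χ) :=
  ⟨fun h => Classical.byContradiction fun hrec =>
      not_shortPairsSchurClose_of_polyDark_piece h𝒞₀ h𝒞₀' hK0 hdarkX hdarkY hrec h,
    shortPairsSchurClose_of_notAEventually⟩

/-- **The specialisation `𝒞₀ = 𝒞₀' = PolyShortPairs`** — the form the closure squad's named inputs plug into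
directly: repaired K0 (stmt-Parity-20459) ∧ darkness of the degree-1 cross AND dual slots on POLYNOMIAL short
pairs for all large `c′` ∧ recurrence of (A)-characters ⇒ `¬ ShortPairsSchurClose`.  When those three inputs are
kernel theorems, the refutation of stmt-Parity-20430 on the recurrent horn is one application of this. -/
theorem not_shortPairsSchurClose_of_polyShortDark_piece
    (hK0 : ∃ c₀ : ℝ, ∀ c' : ℝ, c₀ ≤ c' → InClassMeanPiece c')
    (hdarkX : ∃ c₀ : ℝ, ∀ c' : ℝ, c₀ ≤ c' → InClassMeanPiece c' →
      CrossTablePsiOn c' PolyShortPairs 1 (fun _ _ _ _ => 0))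
    (hdarkY : ∃ c₀ : ℝ, ∀ c' : ℝ, c₀ ≤ c' → InClassMeanPiece c' →
      DualCrossTablePsiOn c' PolyShortPairs 1 (fun _ _ _ _ => 0))
    (hrec : ¬ ForAllLarge (fun D _ χ => ¬ AssumptionA D χ)) :
    ¬ ShortPairsSchurClose :=
  not_shortPairsSchurClose_of_polyDark_piece (fun _ _ _ _ h => h) (fun _ _ _ _ h => h) hK0 hdarkX hdarkY hrec

end Summit.Parity.GeneralizedHardyLittlewood.Theorems
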